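import Literature.MathematicalPhysics.QuantumFieldTheory.BalabanImbrieJaffe1984to88.BIJ88GaussianMoments308
import Mathlib.Analysis.Calculus.Taylor
import Mathlib.MeasureTheory.Integral.DominatedConvergence

/-!
# `BalabanImbrieJaffe1984to88.BIJ88PerturbativeRemainder308` — T. Bałaban, J. Imbrie, A. Jaffe, *Effective action and cluster
properties of the abelian Higgs model*, Commun. Math. Phys. **114** (1988) 257–315 [BalabanImbrieJaffe1988]: Sect. 5.14, p. 308 [PDF 52],
verbatim: *"Thus we define perturbative terms for the action, 𝒫_{k+1} = Σ_{α=1}^{n̄} −(1/α!)(dᵅ/dtᵅ) log z_t|_{t=0}"* (5.14.1) *"and a remainder"*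
(5.14.2) *"Here ⟨·⟩_t is the interacting expectation … with χ′_{Λ^{(k)},t} defined as above replacing p(e_k) with p(te_k)."* — the
DECOMPOSITION `−log z₁ = 𝒫 − 𝓡` for the restricted interacting family `z(t) = ∫ χ′_{Λ,t}·e^{−tW} dP` (both interpolations).

statement-level skeleton of published theorems with citation tags; proofs where landed; nothing here is a claim about the Yang–Mills mass gap

ERRATUM (v1.1, docstring only; referee ref-1 gen 27/28, render `lit-balaban-r16/renders/cmp114/original-p052-x2.png`): print's
(5.14.1) carries a leading MINUS — 𝒫_{k+1}(Λ₁₂^{(k)}) = Σ_{α=1}^{n̄} −(1/α!)(dᵅ/dtᵅ) log z_t(Λ₁₂^{(k)})|_{t=0} — and so does the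
remainder (5.14.2), ℛ_k(Λ₁₂^{(k)}) = ∫₀¹ dt −((1−t)^{n̄}/(n̄+1)!)⟨d/dt; …; d/dt⟩_t; the v1 quotation dropped the sign.  Declarations are
unchanged (the minus lives inside `BIJ88Perturbative341.pertPart`).
Consequently this file's remainder integral 𝓡 := lim_{a→0⁺} ∫_a^1 ((1−t)^{n̄}/n̄!)(d/dt)^{n̄+1} log z_t dt enters as
−log z₁ = 𝒫 − 𝓡, i.e. 𝓡 is MINUS print's ℛ_k up to print's normalisation of the truncated expectation (print's 1/(n̄+1)!
vs Taylor's 1/n̄! is r16's transcript note T9, graded by ref-1: the displayed (n̄+1)! presupposes a truncation one order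
longer); every sign in the theorems below is explicit.

WHAT THIS FILE ADDS.  `BIJ88Perturbative341` proves (3.41)/(5.14.1)-with-remainder for families that are `C^{n̄+1}` ON A NEIGHBOURHOOD OF
`[0,1]` (the pure interaction family `∫ e^{−tW} dμ` is); the restricted family is smooth only on the open branch `(0, e^{−1}/e_k)` and its
Taylor data at `t = 0` exist as LIMITS `t → 0⁺` (`BIJ88GaussianMoments308`: `(dᵅ/dtᵅ) log z_t → (dᵅ/dtᵅ)|₀ cgf_{−W}`).  Here, for
`e_k < e^{−1}` (so that `(0,1]` lies in the branch) and `z_t ≠ 0` on `(0,1]`: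
* §1 `log z` is `C^m` on every `[a,1]`, `0 < a` (`contDiffOn_log_restrictedInteraction`), and TAYLOR'S FORMULA with integral remainder at
  base point `a`: `log z₁ = Σ_{k≤n̄} (1/k!)(1−a)^k (log z)^{(k)}(a) + ∫_a^1 ((1−t)^{n̄}/n̄!)(log z)^{(n̄+1)}(t) dt` (`taylor_log_restrictedInteraction`,
  Mathlib `taylor_integral_remainder`);
* §2 letting `a → 0⁺` (Gaussian marginals as in the prequels): the Taylor polynomial tends to `−pertPart n̄ (cgf_{−W})`
  (`tendsto_taylorPoly_log_restrictedInteraction`), hence **(5.14.1)–(5.14.2): `∫_a^1 ((1−t)^{n̄}/n̄!)(log z)^{(n̄+1)} dt → log z₁ + 𝒫` as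
  `a → 0⁺`, i.e. `−log z₁ = 𝒫 − 𝓡` with `𝒫 = pertPart n̄ (cgf_{−W})` (the Gaussian cumulants, sign convention of (3.41)) and
  `𝓡 = lim_{a→0⁺} ∫_a^1 ((1−t)^{n̄}/n̄!)(d/dt)^{n̄+1} log z_t dt`** — the remainder is the `(n̄+1)`-st truncated expectation of the restricted
  interacting measure along `t ∈ (0,1]` (`tendsto_remainder_restrictedInteraction`); with an integrable remainder density the limit is the
  proper integral `∫₀¹` (`effectiveAction_restrictedInteraction`).

PDF held: `paper:balaban1988-cmp114-bij-abelian-higgs-effective-action` (journal page = PDF page + 256); p. 308 [PDF 52].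

CITATION HEADER (lean-in-tree rule).  Part of the lit-balaban TYPED SKELETON (HOME `run/shared/lean/pub/lit-balaban/`), Phase 2,
seat p36 (gen 7, unit `lit-balaban-p36`); row **C2.Eq5.14.1-5.14.2** of `HOME/lit-balaban-r16/ROWS-C2-part2.md` (owner r16; typed leaves
`Eq5141`/`Eq5142` untouched).  Theorems only; no definitions, no `Prop` facts; axioms standard.
-/

namespace Literature.MathematicalPhysics.QuantumFieldTheory.BalabanImbrieJaffe1984to88.BIJ88PerturbativeRemainder308

open MeasureTheory ProbabilityTheory Filter Set intervalIntegral
open scoped Nat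
open BIJ88Sect2Statements (pLog eK)
open BIJ88Sect5Statements (CutoffProfile cutoff)
open BIJ88Perturbative341 (pertPart)
open scoped Topology

section Taylor

variable (χ : CutoffProfile) {ι Ω : Type*} [MeasurableSpace Ω]

/-! ## §1 Taylor's formula for `log z_t` at a base point `a ∈ (0,1)` -/

/-- For `e_k < e^{−1}` every `t ∈ (0,1]` lies on the branch: `t·e_k < e^{−1}`. [cite: BalabanImbrieJaffe1988, (5.14.2) p.308] -/
theorem mul_lt_exp_neg_one_of_le_one {ek t : ℝ} (hek : 0 < ek) (hek1 : ek < Real.exp (-1)) (ht1 : t ≤ 1) :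
    t * ek < Real.exp (-1) :=
  lt_of_le_of_lt (by nlinarith) hek1

/-- **`log z` is `C^m` at every `t ∈ (0,1]`** (for `e_k < e^{−1}`, `z_t ≠ 0` there), every `m`; `z(t) = ∫ χ′_{Λ,t} e^{−tW} dμ` with ANY
finite measure, measurable fields, `c_b ≠ 0`, measurable `|W| ≤ K`. [cite: BalabanImbrieJaffe1988, (5.14.1) p.308] -/
theorem contDiffAt_log_restrictedInteraction (p : ℝ) (μ : Measure Ω) [IsFiniteMeasure μ] (B : Finset ι) {Φ : ι → Ω → ℝ}
    (hΦ : ∀ b ∈ B, Measurable (Φ b)) {c : ι → ℝ} (hc : ∀ b ∈ B, c b ≠ 0) {W : Ω → ℝ} (hW : Measurable W) {K : ℝ}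
    (hK : ∀ ω, |W ω| ≤ K) {ek : ℝ} (hek : 0 < ek) (hek1 : ek < Real.exp (-1))
    (hz : ∀ t ∈ Set.Ioc (0 : ℝ) 1, (∫ ω, (∏ b ∈ B, cutoff χ (c b * pLog p (t * ek)) (Φ b ω)) * Real.exp (-(t * W ω)) ∂μ) ≠ 0)
    (m : ℕ) {t : ℝ} (ht : t ∈ Set.Ioc (0 : ℝ) 1) :
    ContDiffAt ℝ m (fun t => Real.log (∫ ω, (∏ b ∈ B, cutoff χ (c b * pLog p (t * ek)) (Φ b ω)) * Real.exp (-(t * W ω)) ∂μ)) t := by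
  have h1 : ContDiffAt ℝ m Real.log
      (∫ ω, (∏ b ∈ B, cutoff χ (c b * pLog p (t * ek)) (Φ b ω)) * Real.exp (-(t * W ω)) ∂μ) :=
    Real.contDiffAt_log.mpr (hz t ht)
  have h2 := BIJ88GaussianMoments308.contDiffAt_integral_restrictedInteraction χ p μ B hΦ hc hW hK hek m ht.1
    (mul_lt_exp_neg_one_of_le_one hek hek1 ht.2)
  exact h1.comp t h2

/-- … hence `C^m` on every `[a,1]`, `0 < a ≤ 1`. [cite: BalabanImbrieJaffe1988, (5.14.1) p.308] -/
theorem contDiffOn_log_restrictedInteraction (p : ℝ) (μ : Measure Ω) [IsFiniteMeasure μ] (B : Finset ι) {Φ : ι → Ω → ℝ}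
    (hΦ : ∀ b ∈ B, Measurable (Φ b)) {c : ι → ℝ} (hc : ∀ b ∈ B, c b ≠ 0) {W : Ω → ℝ} (hW : Measurable W) {K : ℝ}
    (hK : ∀ ω, |W ω| ≤ K) {ek : ℝ} (hek : 0 < ek) (hek1 : ek < Real.exp (-1))
    (hz : ∀ t ∈ Set.Ioc (0 : ℝ) 1, (∫ ω, (∏ b ∈ B, cutoff χ (c b * pLog p (t * ek)) (Φ b ω)) * Real.exp (-(t * W ω)) ∂μ) ≠ 0)
    (m : ℕ) {a : ℝ} (ha : 0 < a) :
    ContDiffOn ℝ m (fun t => Real.log (∫ ω, (∏ b ∈ B, cutoff χ (c b * pLog p (t * ek)) (Φ b ω)) * Real.exp (-(t * W ω)) ∂μ))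
      (Set.Icc a 1) := fun _ ht =>
  (contDiffAt_log_restrictedInteraction χ p μ B hΦ hc hW hK hek hek1 hz m ⟨ha.trans_le ht.1, ht.2⟩).contDiffWithinAt

/-- **Taylor's formula with integral remainder for `log z_t` at base point `a ∈ (0,1)`**:
`log z₁ = Σ_{k=0}^{n̄} (1/k!)(1−a)^k (log z)^{(k)}(a) + ∫_a^1 ((1−t)^{n̄}/n̄!)·(log z)^{(n̄+1)}(t) dt`.
[cite: BalabanImbrieJaffe1988, (5.14.2) p.308] -/
theorem taylor_log_restrictedInteraction (p : ℝ) (μ : Measure Ω) [IsFiniteMeasure μ] (B : Finset ι) {Φ : ι → Ω → ℝ}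
    (hΦ : ∀ b ∈ B, Measurable (Φ b)) {c : ι → ℝ} (hc : ∀ b ∈ B, c b ≠ 0) {W : Ω → ℝ} (hW : Measurable W) {K : ℝ}
    (hK : ∀ ω, |W ω| ≤ K) {ek : ℝ} (hek : 0 < ek) (hek1 : ek < Real.exp (-1))
    (hz : ∀ t ∈ Set.Ioc (0 : ℝ) 1, (∫ ω, (∏ b ∈ B, cutoff χ (c b * pLog p (t * ek)) (Φ b ω)) * Real.exp (-(t * W ω)) ∂μ) ≠ 0)
    (nbar : ℕ) {a : ℝ} (ha0 : 0 < a) (ha1 : a < 1) :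
    Real.log (∫ ω, (∏ b ∈ B, cutoff χ (c b * pLog p (1 * ek)) (Φ b ω)) * Real.exp (-(1 * W ω)) ∂μ) =
      (∑ k ∈ Finset.range (nbar + 1), ((k ! : ℝ)⁻¹ * (1 - a) ^ k) *
        iteratedDeriv k (fun t => Real.log
          (∫ ω, (∏ b ∈ B, cutoff χ (c b * pLog p (t * ek)) (Φ b ω)) * Real.exp (-(t * W ω)) ∂μ)) a) +
      ∫ t in a..1, ((1 - t) ^ nbar / (nbar ! : ℝ)) * iteratedDeriv (nbar + 1) (fun t => Real.log
          (∫ ω, (∏ b ∈ B, cutoff χ (c b * pLog p (t * ek)) (Φ b ω)) * Real.exp (-(t * W ω)) ∂μ)) t := by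
  set L : ℝ → ℝ := fun t => Real.log
    (∫ ω, (∏ b ∈ B, cutoff χ (c b * pLog p (t * ek)) (Φ b ω)) * Real.exp (-(t * W ω)) ∂μ) with hL
  have hI : uIcc a 1 = Set.Icc a 1 := uIcc_of_le ha1.le
  have hU : UniqueDiffOn ℝ (uIcc a 1) := by rw [hI]; exact uniqueDiffOn_Icc ha1
  have hmem : ∀ t ∈ uIcc a 1, t ∈ Set.Ioc (0 : ℝ) 1 := fun t ht => by
    rw [hI] at ht; exact ⟨ha0.trans_le ht.1, ht.2⟩
  have hcd : ContDiffOn ℝ (nbar + 1 : ℕ) L (uIcc a 1) := by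
    rw [hI]; exact contDiffOn_log_restrictedInteraction χ p μ B hΦ hc hW hK hek hek1 hz (nbar + 1) ha0
  have h := taylor_integral_remainder (f := L) (x₀ := a) (x := (1 : ℝ)) (n := nbar) hcd
  -- the Taylor polynomial with unrestricted iterated derivatives
  have hP : taylorWithinEval L nbar (uIcc a 1) a 1 =
      ∑ k ∈ Finset.range (nbar + 1), ((k ! : ℝ)⁻¹ * (1 - a) ^ k) * iteratedDeriv k L a := by
    rw [taylor_within_apply]
    refine Finset.sum_congr rfl fun k hk => ?_
    have hk' : (k : WithTop ℕ∞) ≤ (nbar + 1 : ℕ) := by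
      exact_mod_cast (Nat.lt_succ_iff.1 (Finset.mem_range.1 hk)).trans (Nat.le_succ nbar)
    rw [smul_eq_mul, iteratedDerivWithin_eq_iteratedDeriv hU
      ((contDiffAt_log_restrictedInteraction χ p μ B hΦ hc hW hK hek hek1 hz (nbar + 1) (hmem a left_mem_uIcc)).of_le hk')
      left_mem_uIcc]
  -- the remainder with unrestricted iterated derivatives
  have hR : (∫ t in a..1, ((1 - t) ^ nbar / (nbar ! : ℝ)) • iteratedDerivWithin (nbar + 1) L (uIcc a 1) t) =
      ∫ t in a..1, ((1 - t) ^ nbar / (nbar ! : ℝ)) * iteratedDeriv (nbar + 1) L t := by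
    refine intervalIntegral.integral_congr fun t ht => ?_
    simp only [smul_eq_mul]
    rw [iteratedDerivWithin_eq_iteratedDeriv hU
      (contDiffAt_log_restrictedInteraction χ p μ B hΦ hc hW hK hek hek1 hz (nbar + 1) (hmem t ht)) ht]
  rw [hP, hR] at h
  have h1 : L 1 = Real.log (∫ ω, (∏ b ∈ B, cutoff χ (c b * pLog p (1 * ek)) (Φ b ω)) * Real.exp (-(1 * W ω)) ∂μ) := rfl
  rw [← h1]
  linarith

end Taylor

/-! ## §2 `a → 0⁺`: (5.14.1)–(5.14.2) for the restricted interacting family -/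

section Limit

variable (χ : CutoffProfile) {ι Ω : Type*} [MeasurableSpace Ω]

/-- **The Taylor polynomial at base `a` tends to `−𝒫`** as `a → 0⁺`: with CENTERED GAUSSIAN marginals (variances `≤ v`), thresholds
`c_b ≥ c₀ > 0`, `p > 1/2`, measurable `|W| ≤ K`:
`Σ_{k≤n̄} (1/k!)(1−a)^k (log z)^{(k)}(a) → Σ_{k≤n̄} (1/k!)(dᵏ/dtᵏ)|₀ cgf_{−W} = cgf_{−W}(0) − pertPart n̄ (cgf_{−W}) = −pertPart n̄ (cgf_{−W})`.
[cite: BalabanImbrieJaffe1988, (5.14.1) p.308] -/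
theorem tendsto_taylorPoly_log_restrictedInteraction {p : ℝ} (hp : 1 / 2 < p) (P : Measure Ω) [IsProbabilityMeasure P]
    (B : Finset ι) {Φ : ι → Ω → ℝ} (hG : ∀ b ∈ B, HasGaussianLaw (Φ b) P) (hΦ : ∀ b ∈ B, Measurable (Φ b))
    (h0 : ∀ b ∈ B, P[Φ b] = 0) {v : ℝ} (hv : 0 < v) (hvar : ∀ b ∈ B, Var[Φ b; P] ≤ v) {c : ι → ℝ} {c₀ : ℝ} (hc₀ : 0 < c₀)
    (hcb : ∀ b ∈ B, c₀ ≤ c b) {W : Ω → ℝ} (hW : Measurable W) {K : ℝ} (hK : ∀ ω, |W ω| ≤ K) {ek : ℝ} (hek : 0 < ek) (nbar : ℕ) :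
    Tendsto (fun a => ∑ k ∈ Finset.range (nbar + 1), ((k ! : ℝ)⁻¹ * (1 - a) ^ k) *
        iteratedDeriv k (fun t => Real.log
          (∫ ω, (∏ b ∈ B, cutoff χ (c b * pLog p (t * ek)) (Φ b ω)) * Real.exp (-(t * W ω)) ∂P)) a)
      (𝓝[>] (0 : ℝ)) (𝓝 (-pertPart nbar (cgf (fun ω => -W ω) P))) := by
  have hlim : Tendsto (fun a => ∑ k ∈ Finset.range (nbar + 1), ((k ! : ℝ)⁻¹ * (1 - a) ^ k) *
        iteratedDeriv k (fun t => Real.log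
          (∫ ω, (∏ b ∈ B, cutoff χ (c b * pLog p (t * ek)) (Φ b ω)) * Real.exp (-(t * W ω)) ∂P)) a)
      (𝓝[>] (0 : ℝ)) (𝓝 (∑ k ∈ Finset.range (nbar + 1), ((k ! : ℝ)⁻¹ * (1 - 0) ^ k) *
        iteratedDeriv k (cgf (fun ω => -W ω) P) 0)) := by
    refine tendsto_finsetSum _ fun k _ => ?_
    refine Tendsto.mul ?_ (BIJ88GaussianMoments308.tendsto_iteratedDeriv_log_restrictedInteraction_cgf χ hp P B hG hΦ h0 hv
      hvar hc₀ hcb hW hK hek k)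
    have h : Continuous fun a : ℝ => (k ! : ℝ)⁻¹ * (1 - a) ^ k := by continuity
    exact (h.tendsto 0).mono_left nhdsWithin_le_nhds
  have hsum : (∑ k ∈ Finset.range (nbar + 1), ((k ! : ℝ)⁻¹ * (1 - 0) ^ k) * iteratedDeriv k (cgf (fun ω => -W ω) P) 0) =
      -pertPart nbar (cgf (fun ω => -W ω) P) := by
    have h := BIJ88Perturbative341.sum_range_taylor_eq nbar (cgf (fun ω => -W ω) P)
    rw [cgf_zero, zero_sub] at h
    rw [← h]
    refine Finset.sum_congr rfl fun k _ => ?_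
    rw [sub_zero, one_pow, mul_one, one_div]
  rwa [hsum] at hlim

/-- **(5.14.1)–(5.14.2) for the restricted interacting family: `−log z₁ = 𝒫 − 𝓡`.**  For a probability measure with CENTERED GAUSSIAN
marginals `Φ_b` (Mathlib `HasGaussianLaw`, variances `≤ v`), positive thresholds `c_b ≥ c₀ > 0`, `p > 1/2`, `0 < e_k < e^{−1}`, a measurable
interaction `|W| ≤ K`, `z_t = ∫ χ′_{Λ,t} e^{−tW} dP ≠ 0` on `(0,1]`, and every `n̄`:
`∫_a^1 ((1−t)^{n̄}/n̄!)·(d/dt)^{n̄+1} log z_t dt → log z₁ + pertPart n̄ (cgf_{−W})` as `a → 0⁺` — the perturbative terms 𝒫 are the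
Gaussian cumulants and the remainder 𝓡 is the (improper) integral over `t ∈ (0,1]` of the `(n̄+1)`-st truncated expectation of the
restricted interacting measure. [cite: BalabanImbrieJaffe1988, (5.14.2) p.308] -/
theorem tendsto_remainder_restrictedInteraction {p : ℝ} (hp : 1 / 2 < p) (P : Measure Ω) [IsProbabilityMeasure P]
    (B : Finset ι) {Φ : ι → Ω → ℝ} (hG : ∀ b ∈ B, HasGaussianLaw (Φ b) P) (hΦ : ∀ b ∈ B, Measurable (Φ b))
    (h0 : ∀ b ∈ B, P[Φ b] = 0) {v : ℝ} (hv : 0 < v) (hvar : ∀ b ∈ B, Var[Φ b; P] ≤ v) {c : ι → ℝ} {c₀ : ℝ} (hc₀ : 0 < c₀)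
    (hcb : ∀ b ∈ B, c₀ ≤ c b) {W : Ω → ℝ} (hW : Measurable W) {K : ℝ} (hK : ∀ ω, |W ω| ≤ K) {ek : ℝ} (hek : 0 < ek)
    (hek1 : ek < Real.exp (-1))
    (hz : ∀ t ∈ Set.Ioc (0 : ℝ) 1, (∫ ω, (∏ b ∈ B, cutoff χ (c b * pLog p (t * ek)) (Φ b ω)) * Real.exp (-(t * W ω)) ∂P) ≠ 0)
    (nbar : ℕ) :
    Tendsto (fun a => ∫ t in a..1, ((1 - t) ^ nbar / (nbar ! : ℝ)) * iteratedDeriv (nbar + 1) (fun t => Real.log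
          (∫ ω, (∏ b ∈ B, cutoff χ (c b * pLog p (t * ek)) (Φ b ω)) * Real.exp (-(t * W ω)) ∂P)) t)
      (𝓝[>] (0 : ℝ))
      (𝓝 (Real.log (∫ ω, (∏ b ∈ B, cutoff χ (c b * pLog p (1 * ek)) (Φ b ω)) * Real.exp (-(1 * W ω)) ∂P) +
        pertPart nbar (cgf (fun ω => -W ω) P))) := by
  have hcne : ∀ b ∈ B, c b ≠ 0 := fun b hb => (hc₀.trans_le (hcb b hb)).ne'
  have hT := tendsto_taylorPoly_log_restrictedInteraction χ hp P B hG hΦ h0 hv hvar hc₀ hcb hW hK hek nbar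
  -- remainder(a) = log z₁ − TaylorPoly(a) on (0,1)
  have hev : ∀ᶠ a in 𝓝[>] (0 : ℝ), (∫ t in a..1, ((1 - t) ^ nbar / (nbar ! : ℝ)) * iteratedDeriv (nbar + 1) (fun t => Real.log
          (∫ ω, (∏ b ∈ B, cutoff χ (c b * pLog p (t * ek)) (Φ b ω)) * Real.exp (-(t * W ω)) ∂P)) t) =
      Real.log (∫ ω, (∏ b ∈ B, cutoff χ (c b * pLog p (1 * ek)) (Φ b ω)) * Real.exp (-(1 * W ω)) ∂P) -
        ∑ k ∈ Finset.range (nbar + 1), ((k ! : ℝ)⁻¹ * (1 - a) ^ k) *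
          iteratedDeriv k (fun t => Real.log
            (∫ ω, (∏ b ∈ B, cutoff χ (c b * pLog p (t * ek)) (Φ b ω)) * Real.exp (-(t * W ω)) ∂P)) a := by
    have h1 : ∀ᶠ a in 𝓝[>] (0 : ℝ), a < 1 :=
      (tendsto_id.mono_left nhdsWithin_le_nhds).eventually (gt_mem_nhds zero_lt_one)
    filter_upwards [h1, eventually_nhdsWithin_of_forall fun a (ha : a ∈ Set.Ioi (0 : ℝ)) => ha] with a ha1 ha0
    have h := taylor_log_restrictedInteraction χ p P B hΦ hcne hW hK hek hek1 hz nbar ha0 ha1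
    linarith
  have hlim : Tendsto (fun a => Real.log (∫ ω, (∏ b ∈ B, cutoff χ (c b * pLog p (1 * ek)) (Φ b ω)) * Real.exp (-(1 * W ω)) ∂P) -
      ∑ k ∈ Finset.range (nbar + 1), ((k ! : ℝ)⁻¹ * (1 - a) ^ k) *
        iteratedDeriv k (fun t => Real.log
          (∫ ω, (∏ b ∈ B, cutoff χ (c b * pLog p (t * ek)) (Φ b ω)) * Real.exp (-(t * W ω)) ∂P)) a) (𝓝[>] (0 : ℝ))
      (𝓝 (Real.log (∫ ω, (∏ b ∈ B, cutoff χ (c b * pLog p (1 * ek)) (Φ b ω)) * Real.exp (-(1 * W ω)) ∂P) -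
        -pertPart nbar (cgf (fun ω => -W ω) P))) := tendsto_const_nhds.sub hT
  rw [sub_neg_eq_add] at hlim
  exact hlim.congr' (hev.mono fun a h => h.symm)

/-- **With an integrable remainder density the remainder is the proper integral**: if moreover
`t ↦ ((1−t)^{n̄}/n̄!)(d/dt)^{n̄+1} log z_t` is integrable on `[0,1]`, then
`−log z₁ = pertPart n̄ (cgf_{−W}) − ∫₀¹ ((1−t)^{n̄}/n̄!)(d/dt)^{n̄+1} log z_t dt` — (3.41)/(5.14.1)–(5.14.2) verbatim, cf.
`BIJ88Perturbative341.effectiveAction_taylor_integral` for the pure interaction family. [cite: BalabanImbrieJaffe1988, (5.14.2) p.308] -/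
theorem effectiveAction_restrictedInteraction {p : ℝ} (hp : 1 / 2 < p) (P : Measure Ω) [IsProbabilityMeasure P]
    (B : Finset ι) {Φ : ι → Ω → ℝ} (hG : ∀ b ∈ B, HasGaussianLaw (Φ b) P) (hΦ : ∀ b ∈ B, Measurable (Φ b))
    (h0 : ∀ b ∈ B, P[Φ b] = 0) {v : ℝ} (hv : 0 < v) (hvar : ∀ b ∈ B, Var[Φ b; P] ≤ v) {c : ι → ℝ} {c₀ : ℝ} (hc₀ : 0 < c₀)
    (hcb : ∀ b ∈ B, c₀ ≤ c b) {W : Ω → ℝ} (hW : Measurable W) {K : ℝ} (hK : ∀ ω, |W ω| ≤ K) {ek : ℝ} (hek : 0 < ek)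
    (hek1 : ek < Real.exp (-1))
    (hz : ∀ t ∈ Set.Ioc (0 : ℝ) 1, (∫ ω, (∏ b ∈ B, cutoff χ (c b * pLog p (t * ek)) (Φ b ω)) * Real.exp (-(t * W ω)) ∂P) ≠ 0)
    (nbar : ℕ)
    (hint : IntegrableOn (fun t => ((1 - t) ^ nbar / (nbar ! : ℝ)) * iteratedDeriv (nbar + 1) (fun t => Real.log
          (∫ ω, (∏ b ∈ B, cutoff χ (c b * pLog p (t * ek)) (Φ b ω)) * Real.exp (-(t * W ω)) ∂P)) t) (uIcc (0 : ℝ) 1)) :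
    -Real.log (∫ ω, (∏ b ∈ B, cutoff χ (c b * pLog p (1 * ek)) (Φ b ω)) * Real.exp (-(1 * W ω)) ∂P) =
      pertPart nbar (cgf (fun ω => -W ω) P) -
        ∫ t in (0 : ℝ)..1, ((1 - t) ^ nbar / (nbar ! : ℝ)) * iteratedDeriv (nbar + 1) (fun t => Real.log
          (∫ ω, (∏ b ∈ B, cutoff χ (c b * pLog p (t * ek)) (Φ b ω)) * Real.exp (-(t * W ω)) ∂P)) t := by
  set g : ℝ → ℝ := fun t => ((1 - t) ^ nbar / (nbar ! : ℝ)) * iteratedDeriv (nbar + 1) (fun t => Real.log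
          (∫ ω, (∏ b ∈ B, cutoff χ (c b * pLog p (t * ek)) (Φ b ω)) * Real.exp (-(t * W ω)) ∂P)) t with hg
  have hR := tendsto_remainder_restrictedInteraction χ hp P B hG hΦ h0 hv hvar hc₀ hcb hW hK hek hek1 hz nbar
  -- a ↦ ∫_a^1 g = ∫_0^1 g − ∫_0^a g is continuous on [0,1], so its limit at 0⁺ is ∫_0^1 g
  have hcont : ContinuousOn (fun a => ∫ t in (0 : ℝ)..a, g t) (uIcc (0 : ℝ) 1) := continuousOn_primitive_interval hint
  have h0lim : Tendsto (fun a => ∫ t in (0 : ℝ)..a, g t) (𝓝[>] (0 : ℝ)) (𝓝 0) := by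
    have h := (hcont 0 left_mem_uIcc).tendsto
    rw [intervalIntegral.integral_same] at h
    have h' : Tendsto (fun a => ∫ t in (0 : ℝ)..a, g t) (𝓝[Set.Ioo 0 1] (0 : ℝ)) (𝓝 0) :=
      h.mono_left (nhdsWithin_mono _ (by rw [uIcc_of_le zero_le_one]; exact Ioo_subset_Icc_self))
    rwa [nhdsWithin_Ioo_eq_nhdsGT zero_lt_one] at h'
  have hsplit : ∀ᶠ a in 𝓝[>] (0 : ℝ), (∫ t in a..1, g t) = (∫ t in (0 : ℝ)..1, g t) - ∫ t in (0 : ℝ)..a, g t := by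
    have h1 : ∀ᶠ a in 𝓝[>] (0 : ℝ), a < 1 :=
      (tendsto_id.mono_left nhdsWithin_le_nhds).eventually (gt_mem_nhds zero_lt_one)
    filter_upwards [h1, eventually_nhdsWithin_of_forall fun a (ha : a ∈ Set.Ioi (0 : ℝ)) => ha] with a ha1 ha0
    have hI1 : IntervalIntegrable g volume 0 a :=
      (hint.mono_set (by rw [uIcc_of_le zero_le_one, uIcc_of_le ha0.le]; exact Icc_subset_Icc le_rfl ha1.le)).intervalIntegrable
    have hI2 : IntervalIntegrable g volume a 1 :=
      (hint.mono_set (by rw [uIcc_of_le zero_le_one, uIcc_of_le ha1.le]; exact Icc_subset_Icc ha0.le le_rfl)).intervalIntegrable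
    have h := intervalIntegral.integral_add_adjacent_intervals hI1 hI2
    linarith
  have hlim2 : Tendsto (fun a => ∫ t in a..1, g t) (𝓝[>] (0 : ℝ)) (𝓝 ((∫ t in (0 : ℝ)..1, g t) - 0)) :=
    ((tendsto_const_nhds.sub h0lim).congr' (hsplit.mono fun a h => h.symm))
  rw [sub_zero] at hlim2
  have heq := tendsto_nhds_unique hR hlim2
  linarith

end Limit

end Literature.MathematicalPhysics.QuantumFieldTheory.BalabanImbrieJaffe1984to88.BIJ88PerturbativeRemainder308
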